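import Summits.HodgeConjecture.CorCM.Census.BlockParityRelations

/-!
# The block-parity law, III: exactness — the relations `Σ_B` and `Σ_B w̄_B` are independent, so `dim_𝔽₂ span(par(faces)) = β − 1 − δ`, and `δ` does not depend on the base type

COR-CM (cell `pub-hodgecm2`), count-neutral kernel combinatorics by the binder seat b09 (gen 28; lane BLOCK-PARITY-FLOOR),
part III, sequel of `Census/BlockParityLaw.lean` (I) and `Census/BlockParityRelations.lean` (II: `β ≤ dim W + 1 + δ`).
Theorems + two bookkeeping definitions (the functionals `sumFun`, `wFun`); no certificate, no named fact, no `sorry`.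
HONEST FRAMING: `HC_CM` is NOT proved; nothing here is a period or a headline.

CONTENT (`W := span_𝔽₂ (par (gfaceSet))`, `β = Fintype.card (Block c)`, `δ = wdelta c T₀`).
* §1 The functionals `Σ_B x_B` (`sumFun`) and `Σ_B w̄_B x_B` (`wFun`) kill `W` (part I `sum_par_gface`, `wlin_gface`), and
  when the weight parity is constant on blocks they are independent (`w̄(blk T₀) = 0`, `w̄(blk T₀^{(t)}) = 1`):
  `1 + δ ≤ dim W^⊥` (`le_finrank_dualAnnihilator`).
* §2 **`finrank_span_par_gfaceSet_add : dim_𝔽₂ W + 1 + δ = β`** (with II `card_block_le_finrank_add`): the block parities see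
  EXACTLY `β − 1 − δ` independent conditions on the faces.  Corollary **`wdelta_eq_wdelta`**: `δ` is independent of the base
  type `T₀` (so `δ(G, c)` is an invariant of the Galois CM type; part V, `Census/BlockParityTransfer.lean`, identifies it with
  `[∀ g, g^{|G|/2} = 1]` via the transfer `G → ⟨c⟩`).

## References
* [Pohlmann1968] H. Pohlmann, Algebraic cycles on abelian varieties of complex multiplication type, Ann. of Math. 88 (1968), Thm 1.
* [Milne1999] J. S. Milne, Lefschetz motives and the Tate conjecture, Compositio Math. 117 (1999), Prop. 2.1, p. 54.
-/

namespace Summit.HodgeConjecture.CorCM.Census.BlockParity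

open Finset
open Summit.HodgeConjecture.CorCM.Prior.AllgGroup.RfwfAllgGroup

noncomputable section

variable {G : Type*} [Group G] [Fintype G] [DecidableEq G] (c : G)

/-! ## §1 The two annihilating functionals -/

/-- The total-parity functional `x ↦ Σ_B x_B` on `𝔽₂^{blocks}`. [folklore] -/
def sumFun : Module.Dual (ZMod 2) (Block c → ZMod 2) := ∑ B, LinearMap.proj B

/-- The weighted-parity functional `x ↦ Σ_B w̄_B x_B` on `𝔽₂^{blocks}`. [folklore] -/
def wFun (T₀ : CMF G c) : Module.Dual (ZMod 2) (Block c → ZMod 2) := ∑ B, wbar c T₀ B • LinearMap.proj B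

/-- `sumFun x = Σ_B x_B`. [folklore] -/
@[simp] theorem sumFun_apply (x : Block c → ZMod 2) : sumFun c x = ∑ B, x B := by
  simp [sumFun, LinearMap.sum_apply]

/-- `wFun x = Σ_B w̄_B x_B`. [folklore] -/
@[simp] theorem wFun_apply (T₀ : CMF G c) (x : Block c → ZMod 2) : wFun c T₀ x = ∑ B, wbar c T₀ B * x B := by
  simp [wFun, LinearMap.sum_apply]

/-- **`Σ_B` kills the face parities.** [folklore] -/
theorem sumFun_mem_dualAnnihilator (hc2 : c * c = 1) :
    sumFun c ∈ (Submodule.span (ZMod 2) (par c '' gfaceSet G c hc2)).dualAnnihilator := by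
  rw [Submodule.mem_dualAnnihilator]
  have hle : Submodule.span (ZMod 2) (par c '' gfaceSet G c hc2) ≤ LinearMap.ker (sumFun c) := by
    rw [Submodule.span_le]
    rintro _ ⟨y, ⟨Φ, t, t', _, rfl⟩, rfl⟩
    rw [SetLike.mem_coe, LinearMap.mem_ker, sumFun_apply, sum_par_gface]
  exact fun w hw => LinearMap.mem_ker.mp (hle hw)

/-- **`Σ_B w̄_B ·` kills the face parities** when the weight parity is constant on blocks. [folklore] -/
theorem wFun_mem_dualAnnihilator (hc2 : c * c = 1) (T₀ : CMF G c) (hW : ∀ (Q : G) (Ψ : CMF G c), wpar c T₀ (rt c Q Ψ) = wpar c T₀ Ψ) :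
    wFun c T₀ ∈ (Submodule.span (ZMod 2) (par c '' gfaceSet G c hc2)).dualAnnihilator := by
  rw [Submodule.mem_dualAnnihilator]
  have hle : Submodule.span (ZMod 2) (par c '' gfaceSet G c hc2) ≤ LinearMap.ker (wFun c T₀) := by
    rw [Submodule.span_le]
    rintro _ ⟨y, ⟨Φ, t, t', _, rfl⟩, rfl⟩
    rw [SetLike.mem_coe, LinearMap.mem_ker, wFun_apply, sum_wbar_mul_par c T₀ hW, wlin_gface]
  exact fun w hw => LinearMap.mem_ker.mp (hle hw)

/-- `w̄(blk T₀) = 0`. [folklore] -/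
theorem wbar_blk_base (T₀ : CMF G c) (hW : ∀ (Q : G) (Ψ : CMF G c), wpar c T₀ (rt c Q Ψ) = wpar c T₀ Ψ) :
    wbar c T₀ (blk c T₀) = 0 := by
  rw [wbar_blk c T₀ hW]; simp [wpar]

/-- `w̄(blk T₀^{(t)}) = 1`. [folklore] -/
theorem wbar_blk_oflipCM (hc2 : c * c = 1) (T₀ : CMF G c) (hW : ∀ (Q : G) (Ψ : CMF G c), wpar c T₀ (rt c Q Ψ) = wpar c T₀ Ψ) (t : G) :
    wbar c T₀ (blk c (oflipCM c hc2 t T₀)) = 1 := by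
  rw [wbar_blk c T₀ hW, wpar_oflipCM]; simp [wpar]

/-- `sumFun ≠ 0` (there is a block, that of `T₀`). [folklore] -/
theorem sumFun_ne_zero (T₀ : CMF G c) : sumFun c ≠ 0 := by
  classical
  intro h
  have e := congrArg (fun φ : Module.Dual (ZMod 2) (Block c → ZMod 2) => φ (Pi.single (blk c T₀) 1)) h
  simp only [sumFun_apply, LinearMap.zero_apply] at e
  rw [Finset.sum_pi_single'] at e
  simp at e

/-- **The two functionals are independent** when the weight parity is constant on blocks. [folklore] -/
theorem linearIndependent_sumFun_wFun (hc2 : c * c = 1) (T₀ : CMF G c)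
    (hW : ∀ (Q : G) (Ψ : CMF G c), wpar c T₀ (rt c Q Ψ) = wpar c T₀ Ψ) :
    LinearIndependent (ZMod 2) ![sumFun c, wFun c T₀] := by
  classical
  rw [LinearIndependent.pair_iff]
  intro s t hst
  have ev : ∀ x : Block c → ZMod 2, s * (∑ B, x B) + t * (∑ B, wbar c T₀ B * x B) = 0 := by
    intro x
    have e := congrArg (fun φ : Module.Dual (ZMod 2) (Block c → ZMod 2) => φ x) hst
    simpa using e
  have e1 := ev (Pi.single (blk c T₀) 1)
  have e2 := ev (Pi.single (blk c (oflipCM c hc2 1 T₀)) 1)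
  simp only [Pi.single_apply, mul_ite, mul_one, mul_zero, Finset.sum_ite_eq', Finset.mem_univ, if_true] at e1 e2
  rw [wbar_blk_base c T₀ hW] at e1
  rw [wbar_blk_oflipCM c hc2 T₀ hW] at e2
  have key : ∀ s t : ZMod 2, s + t * 0 = 0 → s + t * 1 = 0 → s = 0 ∧ t = 0 := by decide
  exact key s t e1 e2

/-- **Lower bound on the relations**: `1 + δ ≤ dim W^⊥`. [folklore] -/
theorem le_finrank_dualAnnihilator (hc2 : c * c = 1) (T₀ : CMF G c) :
    1 + wdelta c T₀ ≤ Module.finrank (ZMod 2) (Submodule.span (ZMod 2) (par c '' gfaceSet G c hc2)).dualAnnihilator := by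
  classical
  set A := (Submodule.span (ZMod 2) (par c '' gfaceSet G c hc2)).dualAnnihilator
  by_cases hW : ∀ (Q : G) (Ψ : CMF G c), wpar c T₀ (rt c Q Ψ) = wpar c T₀ Ψ
  · rw [wdelta_eq_one c hW]
    have hle : Submodule.span (ZMod 2) (Set.range ![sumFun c, wFun c T₀]) ≤ A := by
      rw [Submodule.span_le]
      rintro _ ⟨i, rfl⟩
      fin_cases i
      · exact sumFun_mem_dualAnnihilator c hc2
      · exact wFun_mem_dualAnnihilator c hc2 T₀ hW
    have h2 := finrank_span_eq_card (linearIndependent_sumFun_wFun c hc2 T₀ hW)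
    simp only [Fintype.card_fin] at h2
    have h3 := Submodule.finrank_mono hle
    omega
  · rw [wdelta_eq_zero c hW]
    have hle : Submodule.span (ZMod 2) {sumFun c} ≤ A := by
      rw [Submodule.span_le]
      rintro _ rfl
      exact sumFun_mem_dualAnnihilator c hc2
    have h2 := finrank_span_singleton (K := ZMod 2) (sumFun_ne_zero c T₀)
    have h3 := Submodule.finrank_mono hle
    omega

/-! ## §2 Exactness and base-type independence of `δ` -/

/-- **EXACT RANK**: `dim_𝔽₂ span(par(faces)) + 1 + δ = β` — the block parities detect exactly `β − 1 − δ` independent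
conditions on the face lattice, no more. [folklore] -/
theorem finrank_span_par_gfaceSet_add (hc2 : c * c = 1) (T₀ : CMF G c) :
    Module.finrank (ZMod 2) (Submodule.span (ZMod 2) (par c '' gfaceSet G c hc2)) + 1 + wdelta c T₀ =
      Fintype.card (Block c) := by
  have h := Subspace.finrank_add_finrank_dualAnnihilator_eq (Submodule.span (ZMod 2) (par c '' gfaceSet G c hc2))
  rw [Module.finrank_fintype_fun_eq_card] at h
  have h1 := finrank_dualAnnihilator_le c hc2 T₀
  have h2 := le_finrank_dualAnnihilator c hc2 T₀
  omega

/-- **`δ` does not depend on the base type.** [folklore] -/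
theorem wdelta_eq_wdelta (hc2 : c * c = 1) (T₀ T₁ : CMF G c) : wdelta c T₀ = wdelta c T₁ := by
  have h0 := finrank_span_par_gfaceSet_add c hc2 T₀
  have h1 := finrank_span_par_gfaceSet_add c hc2 T₁
  omega

/-- The weight parity relative to `T₀` is constant on blocks iff the one relative to `T₁` is. [folklore] -/
theorem wpar_invariant_iff (hc2 : c * c = 1) (T₀ T₁ : CMF G c) :
    (∀ (Q : G) (Ψ : CMF G c), wpar c T₀ (rt c Q Ψ) = wpar c T₀ Ψ) ↔
      ∀ (Q : G) (Ψ : CMF G c), wpar c T₁ (rt c Q Ψ) = wpar c T₁ Ψ := by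
  have h := wdelta_eq_wdelta c hc2 T₀ T₁
  constructor
  · intro h0
    by_contra h1
    rw [wdelta_eq_one c h0, wdelta_eq_zero c h1] at h
    exact absurd h (by decide)
  · intro h1
    by_contra h0
    rw [wdelta_eq_zero c h0, wdelta_eq_one c h1] at h
    exact absurd h (by decide)

end

end Summit.HodgeConjecture.CorCM.Census.BlockParity
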